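import Literature.Computability.Cryptography.QuantumTuringMachineTracks
import Literature.Computability.Cryptography.QubitRegister
import Mathlib.Data.Fintype.Vector
import HarnessLib

/-!
# The quantum stack machine of a sweep machine: registers, cells, rules, the turn unitary

Toolkit file, sequel of `QuantumTuringMachineSweep.lean` (generic oblivious sweep machines) and
`QuantumTuringMachineTracks.lean` (track operations as list scans). It fixes the concrete
`QTM.SweepSpec` used to carry out polynomial-time classical stack programs together with a
queue of qubits (Bernstein–Vazirani 1997, §4: reversible classical subroutines with a history
track; Nishimura–Ozawa 2002, Lemma 5.1: the qubits of a circuit kept on a track, gates applied by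
the finite control):

* `QTM.QSM.QInstr` — instructions: the classical `push`/`pop`/`goto` of the tree's flat binary
  stack programs (`Literature.Computability.Complexity.AInstr`), and the queue instructions
  `qpush b` (append a fresh qubit `|b⟩`), `qrot` (front qubit to the back), `qgate g` (apply the
  gate `g` to the front `arity g` qubits) and `qread` (move the front qubit into the control);
* `QTM.QSM.Prog` — a program: `K` binary stack registers with a distinguished input register
  `U`, a finite unitary gate set, the instruction list (instruction `0` is `goto 1`);
* `QTM.QSM.Prog.Reg` (the finite control register `Φ` of the sweep machine: init flag, current
  instruction, pending record, history-push flag, micro-state, parked qubits) and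
  `QTM.QSM.Prog.Cell` (the live cells: a tag, the qubit track, the history track, the stack
  tracks), with the constant cells `pad`, `anchorL`, `anchorR`, `inp`;
* `QTM.QSM.Prog.turnσ` — the classical part of the right turn (a permutation of `Reg`: leave the
  init sweep, arm the pending record) and `QTM.QSM.Prog.gateAmp` — its quantum part (the gate of
  the current instruction on the parked qubits); `turn_unitary`;
* the cell rules: partial track rules (`pushSpec₂`, `rotSpec₃`, `readSpec`, the history rule
  `hSpec` with commit) completed into bijections (`completeRule`) and lifted to (register, cell)
  pairs (`liftRule`, `LiftLaws`, `liftRule_injective`); the rightward rule `ruleRFun` (init rule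
  on the first sweep; then the history push-and-commit `hR` followed by the operation `opRAt` of
  the effective instruction) and the leftward rule `ruleLFun` (pop / return), both bijective;
* `QTM.QSM.Prog.spec : SweepSpec`, `QTM.QSM.Prog.machine`, its well-formedness and its
  amplitude set (`machine_amplitudes_subset`: `0`, `1` and the gate entries).

All proved; no named fact. The simulation theorem is the sequel `QuantumTuringMachineQSMRun.lean`.

## References

* E. Bernstein, U. Vazirani, *Quantum complexity theory*, SIAM J. Comput. 26 (1997) 1411–1473
  [BernsteinVaziraniSICOMP1997]: §4 (reversible subroutines, history tracks), App. B.
* H. Nishimura, M. Ozawa, Theoret. Comput. Sci. 276 (2002) 147–181 [NishimuraOzawa2002]: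
  Lemma 5.1.
-/

noncomputable section

namespace Literature.Computability.Cryptography

namespace QTM

namespace QSM

open Track
open scoped BigOperators ComplexConjugate

/-! ### Instructions and programs -/

/-- Instructions of the quantum stack machine over `K` binary stack registers and the gate
alphabet `Op`: the classical `push k b` (then the next instruction), `pop k j` (jump to `j o`,
`o` the popped bit or `none`), `goto j`; and the queue instructions `qpush b j`, `qrot j`,
`qgate g j`, `qread j`. [cite: NishimuraOzawa2002, Lemma 5.1] -/
inductive QInstr (K : ℕ) (Op : Type) where
  | push (k : Fin K) (b : Bool) : QInstr K Op
  | pop (k : Fin K) (j : Option Bool → ℕ) : QInstr K Op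
  | goto (j : ℕ) : QInstr K Op
  | qpush (b : Bool) (j : ℕ) : QInstr K Op
  | qrot (j : ℕ) : QInstr K Op
  | qgate (g : Op) (j : ℕ) : QInstr K Op
  | qread (j : ℕ) : QInstr K Op

/-- **A program of the quantum stack machine**: registers `Fin K` with the input register `U`
(initially `1^{n+1}`), a finite unitary gate set `G` whose arities are at most `amax`, and the
instruction list, whose first instruction is the no-op `goto 1` (it is executed virtually by the
hand-over from the first sweep; jumps are clamped into `1, …, L`, so nothing returns to it). [cite: NishimuraOzawa2002, Lemma 5.1] -/
structure Prog where
  /-- number of binary stack registers -/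
  K : ℕ
  /-- the input register (holds `1^{n+1}` initially) -/
  U : Fin K
  /-- the gate set -/
  G : QGateSet
  [finOp : Fintype G.Op]
  [decOp : DecidableEq G.Op]
  unitary : G.IsUnitary
  /-- a bound on the arities (at least one qubit can be parked: the read-out) -/
  amax : ℕ
  amax_pos : 1 ≤ amax
  arity_le : ∀ g, G.arity g ≤ amax
  /-- the instructions -/
  code : List (QInstr K G.Op)
  code_head : code.head? = some (QInstr.goto 1)

attribute [instance] Prog.finOp Prog.decOp

namespace Prog

variable (P : Prog)

/-- The number of instructions. [folklore] -/
abbrev L : ℕ := P.code.length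

/-- Program addresses `0, …, L` (`L` = halted). [folklore] -/
abbrev PC : Type := Fin (P.L + 1)

/-- The program is not empty. [folklore] -/
theorem one_le_L : 1 ≤ P.L := by
  have h := P.code_head
  cases hc : P.code with
  | nil => rw [hc] at h; simp at h
  | cons _ _ => simp [Prog.L, hc]

/-- Clamping a jump target into `1, …, L` (jumps beyond the end halt; address `0` is reserved for
the virtual first instruction). [folklore] -/
def clamp (j : ℕ) : P.PC := ⟨min (max j 1) P.L, by omega⟩

/-- Clamped addresses are positive. [folklore] -/
theorem clamp_pos (j : ℕ) : 1 ≤ (P.clamp j).1 := by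
  have := P.one_le_L; simp [clamp]; omega

/-- The instruction at an address (`none` at `L`). [folklore] -/
def instr (i : P.PC) : Option (QInstr P.K P.G.Op) := P.code[i.1]?

end Prog

/-- The result of an instruction: not a pop, or a pop with its outcome. [cite: BernsteinVaziraniSICOMP1997, §4] -/
inductive PopRes where
  | notpop : PopRes
  | popped (o : Option Bool) : PopRes
  deriving DecidableEq, Fintype

/-- Micro-states of the operating track between two cells of a pass: `idle` is the resting state
in which every operation seeks its hatted cell and to which it returns when done; `puPend` (push:
write pending), `poTook a` (pop: took `a`, the hat goes to the next cell), `roCarry a` / `roPend a`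
(rotation: carrying the front qubit / write pending). [cite: BernsteinVaziraniSICOMP1997, §4] -/
inductive Micro where
  | idle : Micro
  | puPend : Micro
  | poTook (a : Bool) : Micro
  | roCarry (a : Bool) : Micro
  | roPend (a : Bool) : Micro
  deriving DecidableEq, Fintype

/-- Micro-states of a two-phase push (resting = seeking, write pending). [cite: BernsteinVaziraniSICOMP1997, §4] -/
inductive Push2 where
  | seek : Push2
  | pend : Push2
  deriving DecidableEq, Fintype

/-- Micro-states of a rotation returning to rest (seeking, carrying `a`, write of `a` pending). [cite: BernsteinVaziraniSICOMP1997, §4] -/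
inductive Rot3 where
  | seek : Rot3
  | carry (a : Bool) : Rot3
  | pend (a : Bool) : Rot3
  deriving DecidableEq, Fintype

/-- Lists of Booleans of bounded length (the parked qubits). [folklore] -/
abbrev BList (m : ℕ) : Type := {l : List Bool // l.length ≤ m}

/-- Bounded Boolean lists are finitely many. [folklore] -/
instance (m : ℕ) : Fintype (BList m) :=
  Fintype.ofInjective (β := Fin (m + 1) × (Fin m → Bool))
    (fun l => (⟨l.1.length, Nat.lt_succ_of_le l.2⟩, fun i => l.1.getD i false))
    (by
      rintro ⟨l, hl⟩ ⟨l', hl'⟩ h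
      simp only [Prod.mk.injEq, Fin.mk.injEq] at h
      obtain ⟨hlen, hget⟩ := h
      refine Subtype.ext (List.ext_getElem hlen fun i hi hi' => ?_)
      have := congrFun hget ⟨i, lt_of_lt_of_le hi hl⟩
      simpa [List.getD_eq_getElem?_getD, List.getElem?_eq_getElem hi, List.getElem?_eq_getElem hi'] using this)

namespace Prog

variable (P : Prog)

/-- Records pushed on the history track: the instruction executed and its result. [cite: BernsteinVaziraniSICOMP1997, §4] -/
abbrev Rec : Type := P.PC × PopRes

/-- Symbols of the history track: the records. [cite: BernsteinVaziraniSICOMP1997, §4] -/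
abbrev HSym : Type := P.Rec

/-- **The control register** of the sweep machine of `P`: the init flag (first sweep), the current
instruction, the pending record (`some (cur, res)` from the right turn until the history push of
the next rightward pass commits it), the history-push flag (`true` = the top of the history stack
has been unhatted, write pending), the micro-state of the operating track, the parked qubits.
At a sweep boundary the register reads `(false, cur, some (cur, res), false, idle, parked)`. [cite: NishimuraOzawa2002, Lemma 5.1] -/
structure Reg where
  ini : Bool
  cur : P.PC
  last : Option P.Rec
  mh : Bool
  mo : Micro
  parked : BList P.amax
  deriving DecidableEq, Fintype

/-- **The live cells** of the sweep machine of `P`: a tag (marks the right anchor), the qubit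
track, the history track, the `K` stack tracks. [cite: NishimuraOzawa2002, Lemma 5.1] -/
structure Cell where
  tag : Bool
  q : TSym Bool
  h : TSym P.HSym
  regs : Fin P.K → TSym Bool
  deriving DecidableEq, Fintype

/-- The pad cell: all tracks free. [cite: BernsteinVaziraniSICOMP1997, §4] -/
def pad : P.Cell := ⟨false, TSym.free, TSym.free, fun _ => TSym.free⟩

/-- The left anchor cell (position `-1`): anchors of the queue (non-empty: unhatted), of the
history stack (empty: hatted) and of the registers (all empty but `U`). [cite: BernsteinVaziraniSICOMP1997, §4] -/
def anchorL : P.Cell :=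
  ⟨false, TSym.cell Base.anc false, TSym.cell Base.anc true, fun k => TSym.cell Base.anc (decide (k ≠ P.U))⟩

/-- The right anchor cell (position `n`): the dummy back qubit `|0⟩` of the queue (hatted) and the
extra top symbol `1` of the input register `U` (hatted). [cite: BernsteinVaziraniSICOMP1997, §4] -/
def anchorR : P.Cell :=
  ⟨true, TSym.cell (Base.sym false) true, TSym.free,
    fun k => if k = P.U then TSym.cell (Base.sym true) true else TSym.free⟩

/-- Input cells: the input bit as an (unhatted) qubit. [cite: BernsteinVaziraniSICOMP1997, Def. 3.2] -/
def inp (b : Bool) : P.Cell := ⟨false, TSym.cell (Base.sym b) false, TSym.free, fun _ => TSym.free⟩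

/-- The pad is not the left anchor. [folklore] -/
theorem pad_ne_anchorL : P.pad ≠ P.anchorL := by
  intro h; have := congrArg Cell.q h; simp [pad, anchorL] at this

/-- The pad is not the right anchor. [folklore] -/
theorem pad_ne_anchorR : P.pad ≠ P.anchorR := by
  intro h; have := congrArg Cell.tag h; simp [pad, anchorR] at this

/-! ### The classical part of the right turn -/

/-- The init state (the register during the first, rightward input pass). [folklore] -/
def iniReg : P.Reg := ⟨true, 0, none, false, Micro.idle, ⟨[], by simp⟩⟩

/-- The state at the first boundary: the virtual instruction `0` (`goto 1`) has just been executed,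
its record `(0, notpop)` is pending. [folklore] -/
def reg₁ : P.Reg := ⟨false, 0, some (0, PopRes.notpop), false, Micro.idle, ⟨[], by simp⟩⟩

/-- Its disarmed form (never met at a right turn: nothing jumps to address `0`). [folklore] -/
def reg₁' : P.Reg := ⟨false, 0, none, false, Micro.idle, ⟨[], by simp⟩⟩

/-- Arming / disarming the pending record: `none ↔ some (cur, notpop)` on run states (an
involution). [cite: BernsteinVaziraniSICOMP1997, §4] -/
def arm (φ : P.Reg) : P.Reg :=
  if φ.ini then φ
  else match φ.last with
    | none => { φ with last := some (φ.cur, PopRes.notpop) }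
    | some (c, PopRes.notpop) => if c = φ.cur then { φ with last := none } else φ
    | some (_, PopRes.popped _) => φ

/-- Arming is an involution. [folklore] -/
theorem arm_involutive : Function.Involutive P.arm := by
  intro φ
  obtain ⟨ini, cur, last, mh, mo, parked⟩ := φ
  cases ini
  · rcases last with _ | ⟨c, _ | o⟩
    · simp [arm]
    · by_cases hc : c = cur
      · subst hc; simp [arm]
      · simp [arm, hc]
    · simp [arm]
  · simp [arm]

/-- **The classical part of the right turn**: arm the pending record (`none ↦ some (cur, notpop)`),
then swap `iniReg ↔ reg₁` so that the init sweep hands over to the run (a permutation of the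
control register; the swap is harmless since `arm⁻¹ reg₁ = reg₁'` never occurs at a right turn). [cite: BernsteinVaziraniSICOMP1997, §4] -/
def turnσ : Equiv.Perm P.Reg :=
  (Function.Involutive.toPerm P.arm P.arm_involutive).trans (Equiv.swap P.iniReg P.reg₁)

/-- Arming fixes the init state. [folklore] -/
theorem arm_iniReg : P.arm P.iniReg = P.iniReg := by simp [arm, iniReg]
/-- Arming the canonical state. [folklore] -/
theorem arm_reg₁ : P.arm P.reg₁ = P.reg₁' := by simp [arm, reg₁, reg₁']
/-- Disarming the armed canonical state. [folklore] -/
theorem arm_reg₁' : P.arm P.reg₁' = P.reg₁ := by simp [arm, reg₁, reg₁']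

/-- `reg₁ ≠ iniReg`. [folklore] -/
theorem reg₁_ne_iniReg : P.reg₁ ≠ P.iniReg := by simp [reg₁, iniReg]
/-- `reg₁' ≠ iniReg`. [folklore] -/
theorem reg₁'_ne_iniReg : P.reg₁' ≠ P.iniReg := by simp [reg₁', iniReg]
/-- `reg₁' ≠ reg₁`. [folklore] -/
theorem reg₁'_ne_reg₁ : P.reg₁' ≠ P.reg₁ := by simp [reg₁', reg₁]

/-- The turn leaves the init sweep into the canonical state. [folklore] -/
theorem turnσ_iniReg : P.turnσ P.iniReg = P.reg₁ := by
  show Equiv.swap P.iniReg P.reg₁ (P.arm P.iniReg) = _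
  rw [arm_iniReg, Equiv.swap_apply_left]

/-- On a run state with no pending record (other than `reg₁'`), the turn arms the record. [folklore] -/
theorem turnσ_of_last_none (φ : P.Reg) (hini : φ.ini = false) (hlast : φ.last = none) (hne : φ ≠ P.reg₁') :
    P.turnσ φ = { φ with last := some (φ.cur, PopRes.notpop) } := by
  have harm : P.arm φ = { φ with last := some (φ.cur, PopRes.notpop) } := by
    obtain ⟨ini, cur, last, mh, mo, parked⟩ := φ
    simp only at hini hlast; subst hini hlast; simp [arm]
  have h1 : P.arm φ ≠ P.iniReg := by rw [harm]; simp [iniReg, hini]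
  have h2 : P.arm φ ≠ P.reg₁ := by
    rw [← P.arm_reg₁']
    exact fun h => hne (P.arm_involutive.injective h)
  show Equiv.swap P.iniReg P.reg₁ (P.arm φ) = _
  rw [Equiv.swap_apply_of_ne_of_ne h1 h2, harm]

/-! ### The quantum part of the right turn: the gate of the current instruction -/

/-- The gate symbol of the current instruction, if it is a gate instruction. [folklore] -/
def gateOf (φ : P.Reg) : Option P.G.Op :=
  match P.instr φ.cur with
  | some (QInstr.qgate g _) => some g
  | _ => none

/-- The parked qubits as a register of `k` qubits (when there are exactly `k` of them). [folklore] -/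
def vecOf {k : ℕ} (l : List Bool) (h : l.length = k) : QReg k := fun i => l[i.1]'(by omega)

/-- Two control states agree up to the parked qubits. [folklore] -/
def SameButParked (φ ψ : P.Reg) : Prop :=
  φ.ini = ψ.ini ∧ φ.cur = ψ.cur ∧ φ.last = ψ.last ∧ φ.mh = ψ.mh ∧ φ.mo = ψ.mo

/-- `SameButParked` is decidable. [folklore] -/
instance : DecidableRel P.SameButParked := fun _ _ => by unfold SameButParked; infer_instance

/-- The gate block of a control state: a gate instruction is current and exactly `arity` qubits
are parked. [folklore] -/
def InGate (φ : P.Reg) (g : P.G.Op) : Prop := P.gateOf φ = some g ∧ φ.parked.1.length = P.G.arity g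

/-- Being in a gate block is decidable. [folklore] -/
instance (g : P.G.Op) : DecidablePred (fun φ => P.InGate φ g) := fun _ => by unfold InGate; infer_instance

/-- **The gate amplitude** from control state `φ` to `ψ`: the matrix entry of the current gate
between the parked registers when `φ`, `ψ` are in the same gate block, `[φ = ψ]` outside gate
blocks (Nishimura–Ozawa 2002, Lemma 5.1: the finite control applies the gate to the qubits it
holds). [cite: NishimuraOzawa2002, Lemma 5.1] -/
def gateAmp (φ ψ : P.Reg) : ℂ :=
  match P.gateOf φ with
  | some g =>
      if h : φ.parked.1.length = P.G.arity g then
        if h' : P.SameButParked φ ψ ∧ ψ.parked.1.length = P.G.arity g then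
          P.G.mat g (vecOf ψ.parked.1 h'.2) (vecOf φ.parked.1 h)
        else 0
      else if φ = ψ then 1 else 0
  | none => if φ = ψ then 1 else 0

/-- `vecOf` of `List.ofFn`. [folklore] -/
theorem vecOf_ofFn {k : ℕ} (z : QReg k) (h : (List.ofFn z).length = k) : vecOf (List.ofFn z) h = z := by
  funext i; simp [vecOf]

/-- `List.ofFn` of `vecOf`. [folklore] -/
theorem ofFn_vecOf {k : ℕ} (l : List Bool) (h : l.length = k) : List.ofFn (vecOf l h) = l := by
  subst h; exact List.ofFn_getElem

/-- Replacing the parked qubits by a register of `k ≤ amax` qubits. [folklore] -/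
def withParked (φ : P.Reg) {k : ℕ} (hk : k ≤ P.amax) (z : QReg k) : P.Reg :=
  { φ with parked := ⟨List.ofFn z, by simpa using hk⟩ }

/-- `withParked` is injective. [folklore] -/
theorem withParked_injective (φ : P.Reg) {k : ℕ} (hk : k ≤ P.amax) :
    Function.Injective (P.withParked φ hk) := by
  intro z z' h
  have := congrArg (fun r : P.Reg => r.parked.1) h
  simp only [withParked] at this
  exact List.ofFn_injective this

/-- `SameButParked` is reflexive. [folklore] -/
theorem sameButParked_refl (φ : P.Reg) : P.SameButParked φ φ := ⟨rfl, rfl, rfl, rfl, rfl⟩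

variable {P} in
/-- `SameButParked` is symmetric. [folklore] -/
theorem SameButParked.symm {φ ψ : P.Reg} (h : P.SameButParked φ ψ) : P.SameButParked ψ φ :=
  ⟨h.1.symm, h.2.1.symm, h.2.2.1.symm, h.2.2.2.1.symm, h.2.2.2.2.symm⟩

variable {P} in
/-- `SameButParked` is transitive. [folklore] -/
theorem SameButParked.trans {φ ψ χ : P.Reg} (h : P.SameButParked φ ψ) (h' : P.SameButParked ψ χ) :
    P.SameButParked φ χ :=
  ⟨h.1.trans h'.1, h.2.1.trans h'.2.1, h.2.2.1.trans h'.2.2.1, h.2.2.2.1.trans h'.2.2.2.1,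
    h.2.2.2.2.trans h'.2.2.2.2⟩

/-- States agreeing up to parked qubits and in the parked qubits are equal. [folklore] -/
theorem eq_of_sameButParked {φ ψ : P.Reg} (h : P.SameButParked φ ψ) (hp : φ.parked = ψ.parked) : φ = ψ := by
  obtain ⟨a, b, c, d, e, f⟩ := φ
  obtain ⟨a', b', c', d', e', f'⟩ := ψ
  obtain ⟨h1, h2, h3, h4, h5⟩ := h
  simp only at h1 h2 h3 h4 h5 hp
  subst h1 h2 h3 h4 h5 hp
  rfl

/-- `gateOf` only depends on the current instruction. [folklore] -/
theorem gateOf_eq_of_sameButParked {φ ψ : P.Reg} (h : P.SameButParked φ ψ) : P.gateOf φ = P.gateOf ψ := by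
  unfold gateOf; rw [h.2.1]

/-- `withParked` stays in the class. [folklore] -/
theorem sameButParked_withParked (φ : P.Reg) {k : ℕ} (hk : k ≤ P.amax) (z : QReg k) :
    P.SameButParked φ (P.withParked φ hk z) := ⟨rfl, rfl, rfl, rfl, rfl⟩

/-- The gate amplitude, in a gate block. [folklore] -/
theorem gateAmp_of_inGate {φ : P.Reg} {g : P.G.Op} (hg : P.gateOf φ = some g)
    (hk : φ.parked.1.length = P.G.arity g) (χ : P.Reg) :
    P.gateAmp φ χ = if h' : P.SameButParked φ χ ∧ χ.parked.1.length = P.G.arity g then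
      P.G.mat g (vecOf χ.parked.1 h'.2) (vecOf φ.parked.1 hk) else 0 := by
  unfold gateAmp
  rw [hg]
  dsimp only
  rw [dif_pos hk]

/-- The gate amplitude, outside gate blocks: the identity. [folklore] -/
theorem gateAmp_of_not_inGate {φ : P.Reg} (h : ∀ g, P.gateOf φ = some g → φ.parked.1.length ≠ P.G.arity g)
    (χ : P.Reg) : P.gateAmp φ χ = if φ = χ then 1 else 0 := by
  unfold gateAmp
  cases hg : P.gateOf φ with
  | none => rfl
  | some g => simp only [dif_neg (h g hg)]

/-- Sums over a gate block are sums over the register of parked qubits. [folklore] -/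
theorem sum_block (φ : P.Reg) {k : ℕ} (hk : k ≤ P.amax) {β : Type*} [AddCommMonoid β] (f : P.Reg → β) :
    ∑ χ : P.Reg, (if P.SameButParked φ χ ∧ χ.parked.1.length = k then f χ else 0) =
      ∑ z : QReg k, f (P.withParked φ hk z) := by
  classical
  rw [← Finset.sum_filter]
  refine Finset.sum_nbij' (fun χ => if h : χ.parked.1.length = k then vecOf χ.parked.1 h else fun _ => false)
    (fun z => P.withParked φ hk z) (by simp) (fun χ hχ => ?_) (fun χ hχ => ?_) (fun z _ => ?_) (fun χ hχ => ?_)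
  · simp only [Finset.mem_filter, Finset.mem_univ, true_and]
    exact ⟨P.sameButParked_withParked φ hk _, by simp [withParked]⟩
  · obtain ⟨h1, h2⟩ := (Finset.mem_filter.1 hχ).2
    rw [dif_pos h2]
    refine P.eq_of_sameButParked ((P.sameButParked_withParked φ hk _).symm.trans h1) ?_
    exact Subtype.ext (ofFn_vecOf _ h2)
  · have hlen : (P.withParked φ hk z).parked.1.length = k := by simp [withParked]
    rw [dif_pos hlen]
    exact vecOf_ofFn z _
  · obtain ⟨h1, h2⟩ := (Finset.mem_filter.1 hχ).2
    rw [dif_pos h2]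
    congr 1
    exact (P.eq_of_sameButParked ((P.sameButParked_withParked φ hk _).symm.trans h1)
      (Subtype.ext (ofFn_vecOf _ h2))).symm

/-- Column orthonormality of a unitary gate matrix. [folklore] -/
theorem sum_conj_mul_of_unitary {k : ℕ} {U : Matrix (QReg k) (QReg k) ℂ}
    (hU : U ∈ Matrix.unitaryGroup (QReg k) ℂ) (x y : QReg k) :
    ∑ z : QReg k, conj (U z x) * U z y = if x = y then 1 else 0 := by
  have h := Matrix.mem_unitaryGroup_iff'.1 hU
  have := congrFun (congrFun h x) y
  rw [Matrix.mul_apply, Matrix.one_apply] at this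
  simpa [Matrix.star_apply] using this

/-- **The gate amplitude is unitary** (its rows are orthonormal): block by block it is the gate
matrix of the current instruction, a unitary, or the identity. [cite: NishimuraOzawa2002, Lemma 5.1] -/
theorem gateAmp_unitary (φ ψ : P.Reg) :
    ∑ χ : P.Reg, conj (P.gateAmp φ χ) * P.gateAmp ψ χ = if φ = ψ then 1 else 0 := by
  classical
  by_cases hφ : ∃ g, P.gateOf φ = some g ∧ φ.parked.1.length = P.G.arity g
  · obtain ⟨g, hg, hk⟩ := hφ
    have hka : P.G.arity g ≤ P.amax := P.arity_le g
    by_cases hψ : P.SameButParked φ ψ ∧ ψ.parked.1.length = P.G.arity g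
    · -- same block: the unitarity of the gate matrix
      obtain ⟨hsb, hk'⟩ := hψ
      have hg' : P.gateOf ψ = some g := (P.gateOf_eq_of_sameButParked hsb) ▸ hg
      calc ∑ χ, conj (P.gateAmp φ χ) * P.gateAmp ψ χ
          = ∑ χ : P.Reg, (if P.SameButParked φ χ ∧ χ.parked.1.length = P.G.arity g then
              (if h' : χ.parked.1.length = P.G.arity g then
                conj (P.G.mat g (vecOf χ.parked.1 h') (vecOf φ.parked.1 hk)) *
                  P.G.mat g (vecOf χ.parked.1 h') (vecOf ψ.parked.1 hk') else 0) else 0) := by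
            refine Finset.sum_congr rfl fun χ _ => ?_
            rw [P.gateAmp_of_inGate hg hk, P.gateAmp_of_inGate hg' hk']
            by_cases h1 : P.SameButParked φ χ ∧ χ.parked.1.length = P.G.arity g
            · have h2 : P.SameButParked ψ χ ∧ χ.parked.1.length = P.G.arity g := ⟨hsb.symm.trans h1.1, h1.2⟩
              rw [dif_pos h1, dif_pos h2, if_pos h1, dif_pos h1.2]
            · have h2 : ¬ (P.SameButParked ψ χ ∧ χ.parked.1.length = P.G.arity g) :=
                fun h2 => h1 ⟨hsb.trans h2.1, h2.2⟩
              rw [dif_neg h1, dif_neg h2, if_neg h1]; simp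
        _ = ∑ z : QReg (P.G.arity g), conj (P.G.mat g z (vecOf φ.parked.1 hk)) * P.G.mat g z (vecOf ψ.parked.1 hk') := by
            rw [P.sum_block φ hka]
            refine Finset.sum_congr rfl fun z _ => ?_
            have hlen : (P.withParked φ hka z).parked.1.length = P.G.arity g := by simp [withParked]
            rw [dif_pos hlen]
            simp only [withParked, vecOf_ofFn]
        _ = if vecOf φ.parked.1 hk = vecOf ψ.parked.1 hk' then 1 else 0 := sum_conj_mul_of_unitary (P.unitary g) _ _
        _ = if φ = ψ then 1 else 0 := by
            by_cases h : φ = ψ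
            · subst h; simp
            · rw [if_neg h, if_neg]
              intro hv
              apply h
              refine P.eq_of_sameButParked hsb (Subtype.ext ?_)
              rw [← ofFn_vecOf _ hk, ← ofFn_vecOf _ hk', hv]
    · -- `ψ` outside the block of `φ`: orthogonal rows, and `φ ≠ ψ`
      have hne : φ ≠ ψ := by rintro rfl; exact hψ ⟨P.sameButParked_refl φ, hk⟩
      rw [if_neg hne]
      by_cases hψ' : ∃ g', P.gateOf ψ = some g' ∧ ψ.parked.1.length = P.G.arity g'
      · obtain ⟨g', hg', hk'⟩ := hψ'
        refine Finset.sum_eq_zero fun χ _ => ?_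
        rw [P.gateAmp_of_inGate hg hk, P.gateAmp_of_inGate hg' hk']
        by_cases h1 : P.SameButParked φ χ ∧ χ.parked.1.length = P.G.arity g
        · have h2 : ¬ (P.SameButParked ψ χ ∧ χ.parked.1.length = P.G.arity g') := by
            rintro ⟨h2, h3⟩
            have hsb : P.SameButParked φ ψ := h1.1.trans h2.symm
            have : g = g' := by
              have := (P.gateOf_eq_of_sameButParked hsb).symm.trans hg |>.symm.trans hg'
              exact Option.some.inj this
            subst this
            exact hψ ⟨hsb, hk'⟩
          rw [dif_neg h2, mul_zero]
        · rw [dif_neg h1, map_zero, zero_mul]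
      · push Not at hψ'
        have hrow : ∀ χ, P.gateAmp ψ χ = if ψ = χ then 1 else 0 := P.gateAmp_of_not_inGate hψ'
        simp_rw [hrow]
        rw [Finset.sum_eq_single ψ (fun χ _ hχ => by rw [if_neg (Ne.symm hχ), mul_zero]) (by simp)]
        rw [if_pos rfl, mul_one, P.gateAmp_of_inGate hg hk, dif_neg (fun h => hψ h), map_zero]
  · push Not at hφ
    have hrow : ∀ χ, P.gateAmp φ χ = if φ = χ then 1 else 0 := P.gateAmp_of_not_inGate hφ
    simp_rw [hrow]
    rw [Finset.sum_eq_single φ (fun χ _ hχ => by rw [if_neg (Ne.symm hχ), map_zero, zero_mul]) (by simp)]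
    rw [if_pos rfl, map_one, one_mul]
    by_cases hψ : ∃ g, P.gateOf ψ = some g ∧ ψ.parked.1.length = P.G.arity g
    · obtain ⟨g, hg, hk⟩ := hψ
      have hne : φ ≠ ψ := by rintro rfl; exact hφ g hg hk
      rw [if_neg hne, P.gateAmp_of_inGate hg hk, dif_neg]
      rintro ⟨hsb, hk'⟩
      have := P.gateOf_eq_of_sameButParked hsb
      exact hφ g (this ▸ hg) hk'
    · push Not at hψ
      rw [P.gateAmp_of_not_inGate hψ]
      exact if_congr eq_comm rfl rfl

/-- **The turn unitary** of the sweep machine of `P`: the classical permutation `turnσ` followed by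
the gate amplitude. [cite: NishimuraOzawa2002, Lemma 5.1] -/
def turn (φ ψ : P.Reg) : ℂ := P.gateAmp (P.turnσ φ) ψ

/-- The turn unitary is unitary. [cite: NishimuraOzawa2002, Lemma 5.1] -/
theorem turn_unitary (φ ψ : P.Reg) : ∑ χ : P.Reg, conj (P.turn φ χ) * P.turn ψ χ = if φ = ψ then 1 else 0 := by
  unfold turn
  rw [P.gateAmp_unitary]
  simp [P.turnσ.injective.eq_iff]

/-! ### Lifting track bijections to (register, cell) pairs -/

section Lift

variable {P}
variable {S α : Type}

/-- **A lifted track rule.** `perm` acts on (track state, track symbol); `dec`/`enc` read and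
write the track state inside the control register (`dec φ = none`: the register is not in a
state of this operation — the rule is then the identity), `get`/`set` read and write the track
inside the cell. [cite: BernsteinVaziraniSICOMP1997, §4] -/
def liftRule (perm : S × TSym α → S × TSym α) (dec : P.Reg → Option S) (enc : P.Reg → S → P.Reg)
    (get : P.Cell → TSym α) (set : P.Cell → TSym α → P.Cell) (x : P.Reg × P.Cell) : P.Reg × P.Cell :=
  match dec x.1 with
  | none => x
  | some s => (enc x.1 (perm (s, get x.2)).1, set x.2 (perm (s, get x.2)).2)

/-- The laws making a lift injective: `dec`/`enc` and `get`/`set` are the two halves of a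
product decomposition. [folklore] -/
structure LiftLaws (dec : P.Reg → Option S) (enc : P.Reg → S → P.Reg) (get : P.Cell → TSym α)
    (set : P.Cell → TSym α → P.Cell) : Prop where
  dec_enc : ∀ φ s s₀, dec φ = some s₀ → dec (enc φ s) = some s
  enc_dec : ∀ φ s, dec φ = some s → enc φ s = φ
  enc_inj : ∀ φ φ' s s' s₀ s₀', dec φ = some s₀ → dec φ' = some s₀' → enc φ s = enc φ' s' →
    s = s' ∧ ∀ t, enc φ t = enc φ' t
  get_set : ∀ c t, get (set c t) = t
  set_get : ∀ c, set c (get c) = c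
  set_inj : ∀ c c' t t', set c t = set c' t' → t = t' ∧ ∀ u, set c u = set c' u

/-- On registers in a state of the operation, the lift acts through the track rule. [folklore] -/
theorem liftRule_enc {perm : S × TSym α → S × TSym α} {dec : P.Reg → Option S} {enc : P.Reg → S → P.Reg}
    {get : P.Cell → TSym α} {set : P.Cell → TSym α → P.Cell} (hl : LiftLaws dec enc get set)
    (φ : P.Reg) (s₀ : S) (h₀ : dec φ = some s₀) (s : S) (c : P.Cell) :
    liftRule perm dec enc get set (enc φ s, c) = (enc φ (perm (s, get c)).1, set c (perm (s, get c)).2) := by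
  unfold liftRule
  rw [hl.dec_enc φ s s₀ h₀]
  simp only
  have hs : dec (enc φ s) = some s := hl.dec_enc φ s s₀ h₀
  obtain ⟨-, h2⟩ := hl.enc_inj (enc φ s) φ s s s s₀ hs h₀ (hl.enc_dec _ _ hs)
  rw [h2]

/-- **A lift of an injective track rule is injective.** [cite: BernsteinVaziraniSICOMP1997, App. B (Def. B.1)] -/
theorem liftRule_injective {perm : S × TSym α → S × TSym α} (hperm : Function.Injective perm)
    {dec : P.Reg → Option S} {enc : P.Reg → S → P.Reg} {get : P.Cell → TSym α} {set : P.Cell → TSym α → P.Cell}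
    (hl : LiftLaws dec enc get set) : Function.Injective (liftRule perm dec enc get set) := by
  rintro ⟨φ, c⟩ ⟨φ', c'⟩ h
  unfold liftRule at h
  cases hφ : dec φ with
  | none =>
    cases hφ' : dec φ' with
    | none => rw [hφ, hφ'] at h; exact h
    | some s' =>
      rw [hφ, hφ'] at h
      simp only at h
      -- an identity target is not a lift target: `dec` tells them apart
      have h1 := congrArg (fun x : P.Reg × P.Cell => dec x.1) h
      simp only at h1
      rw [hφ, hl.dec_enc φ' _ s' hφ'] at h1
      exact absurd h1 (by simp)
  | some s =>
    cases hφ' : dec φ' with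
    | none =>
      rw [hφ, hφ'] at h
      simp only at h
      have h1 := congrArg (fun x : P.Reg × P.Cell => dec x.1) h
      simp only at h1
      rw [hφ', hl.dec_enc φ _ s hφ] at h1
      exact absurd h1 (by simp)
    | some s' =>
      rw [hφ, hφ'] at h
      simp only [Prod.mk.injEq] at h
      obtain ⟨he, hs⟩ := h
      obtain ⟨h1, h2⟩ := hl.enc_inj φ φ' _ _ s s' hφ hφ' he
      obtain ⟨h3, h4⟩ := hl.set_inj c c' _ _ hs
      have hp : perm (s, get c) = perm (s', get c') := Prod.ext h1 h3
      have := hperm hp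
      simp only [Prod.mk.injEq] at this
      obtain ⟨rfl, hget⟩ := this
      refine Prod.ext ?_ ?_
      · rw [← hl.enc_dec φ s hφ, h2, hl.enc_dec φ' s hφ']
      · rw [← hl.set_get c, h4, hget, hl.set_get]

end Lift

/-! ### Track accessors of the cells -/

/-- Read the qubit track. [folklore] -/
abbrev getQ (c : P.Cell) : TSym Bool := c.q
/-- Write the qubit track. [folklore] -/
abbrev setQ (c : P.Cell) (t : TSym Bool) : P.Cell := { c with q := t }
/-- Read the history track. [folklore] -/
abbrev getH (c : P.Cell) : TSym P.HSym := c.h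
/-- Write the history track. [folklore] -/
abbrev setH (c : P.Cell) (t : TSym P.HSym) : P.Cell := { c with h := t }
/-- Read a stack track. [folklore] -/
abbrev getR (k : Fin P.K) (c : P.Cell) : TSym Bool := c.regs k
/-- Write a stack track. [folklore] -/
abbrev setR (k : Fin P.K) (c : P.Cell) (t : TSym Bool) : P.Cell := { c with regs := Function.update c.regs k t }

/-- Reading back the qubit track. [folklore] -/
theorem getQ_setQ (c : P.Cell) (t : TSym Bool) : P.getQ (P.setQ c t) = t := rfl
/-- Writing the qubit track with its own content. [folklore] -/
theorem setQ_getQ (c : P.Cell) : P.setQ c (P.getQ c) = c := rfl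
/-- Writing the qubit track is injective in the content and forgets only the track. [folklore] -/
theorem setQ_inj (c c' : P.Cell) (t t' : TSym Bool) (h : P.setQ c t = P.setQ c' t') :
    t = t' ∧ ∀ u, P.setQ c u = P.setQ c' u := by
  obtain ⟨a, b, d, e⟩ := c; obtain ⟨a', b', d', e'⟩ := c'
  simp only [setQ, Cell.mk.injEq] at h ⊢
  obtain ⟨h1, h2, h3, h4⟩ := h
  exact ⟨h2, fun u => by simp [h1, h3, h4]⟩

/-- Reading back the history track. [folklore] -/
theorem getH_setH (c : P.Cell) (t : TSym P.HSym) : P.getH (P.setH c t) = t := rfl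
/-- Writing the history track with its own content. [folklore] -/
theorem setH_getH (c : P.Cell) : P.setH c (P.getH c) = c := rfl
/-- Writing the history track is injective in the content and forgets only the track. [folklore] -/
theorem setH_inj (c c' : P.Cell) (t t' : TSym P.HSym) (h : P.setH c t = P.setH c' t') :
    t = t' ∧ ∀ u, P.setH c u = P.setH c' u := by
  obtain ⟨a, b, d, e⟩ := c; obtain ⟨a', b', d', e'⟩ := c'
  simp only [setH, Cell.mk.injEq] at h ⊢
  obtain ⟨h1, h2, h3, h4⟩ := h
  exact ⟨h3, fun u => by simp [h1, h2, h4]⟩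

/-- Reading back a stack track. [folklore] -/
theorem getR_setR (k : Fin P.K) (c : P.Cell) (t : TSym Bool) : P.getR k (P.setR k c t) = t := by
  simp [getR]
/-- Writing a stack track with its own content. [folklore] -/
theorem setR_getR (k : Fin P.K) (c : P.Cell) : P.setR k c (P.getR k c) = c := by
  obtain ⟨a, b, d, e⟩ := c; simp [getR, setR]
/-- Writing a stack track is injective in the content and forgets only the track. [folklore] -/
theorem setR_inj (k : Fin P.K) (c c' : P.Cell) (t t' : TSym Bool) (h : P.setR k c t = P.setR k c' t') :
    t = t' ∧ ∀ u, P.setR k c u = P.setR k c' u := by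
  obtain ⟨a, b, d, e⟩ := c; obtain ⟨a', b', d', e'⟩ := c'
  simp only [setR, Cell.mk.injEq] at h ⊢
  obtain ⟨h1, h2, h3, h4⟩ := h
  have ht : t = t' := by simpa using congrFun h4 k
  refine ⟨ht, fun u => ⟨h1, h2, h3, ?_⟩⟩
  funext i
  by_cases hi : i = k
  · subst hi; simp
  · have := congrFun h4 i
    simp only [Function.update_of_ne hi] at this
    simp [Function.update_of_ne hi, this]

/-! ### State codes of the operations -/

section Codes

/-- Decode a push state: resting / write pending. [folklore] -/
def decPush (φ : P.Reg) : Option Push2 :=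
  match φ.mo with
  | Micro.idle => some Push2.seek
  | Micro.puPend => some Push2.pend
  | _ => none

/-- Encode a push state. [folklore] -/
def encPush (φ : P.Reg) : Push2 → P.Reg
  | Push2.seek => { φ with mo := Micro.idle }
  | Push2.pend => { φ with mo := Micro.puPend }

/-- Decoding an encoded push state. [folklore] -/
theorem decPush_encPush (φ : P.Reg) (s : Push2) : P.decPush (P.encPush φ s) = some s := by
  cases s <;> rfl

/-- Decode a rotation state. [folklore] -/
def decRot (φ : P.Reg) : Option Rot3 :=
  match φ.mo with
  | Micro.idle => some Rot3.seek
  | Micro.roCarry a => some (Rot3.carry a)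
  | Micro.roPend a => some (Rot3.pend a)
  | _ => none

/-- Encode a rotation state. [folklore] -/
def encRot (φ : P.Reg) : Rot3 → P.Reg
  | Rot3.seek => { φ with mo := Micro.idle }
  | Rot3.carry a => { φ with mo := Micro.roCarry a }
  | Rot3.pend a => { φ with mo := Micro.roPend a }

/-- Decoding an encoded rotation state. [folklore] -/
theorem decRot_encRot (φ : P.Reg) (s : Rot3) : P.decRot (P.encRot φ s) = some s := by
  cases s <;> rfl

/-- Decode the parked qubits (gather / return / read act on them in micro-state `idle`). [folklore] -/
def decPark (φ : P.Reg) : Option (BList P.amax) := if φ.mo = Micro.idle then some φ.parked else none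

/-- Encode the parked qubits. [folklore] -/
def encPark (φ : P.Reg) (l : BList P.amax) : P.Reg := { φ with parked := l }

/-- Decode a pop state: the pending record is the armed one (`(cur, notpop)`) while seeking and
taking, and `(cur, popped o)` once done (the result lives in the pending record). [folklore] -/
def decPop (φ : P.Reg) : Option (PopSt Bool) :=
  match φ.mo, φ.last with
  | Micro.idle, some (c, PopRes.notpop) => if c = φ.cur then some PopSt.seek else none
  | Micro.poTook a, some (c, PopRes.notpop) => if c = φ.cur then some (PopSt.took a) else none
  | Micro.idle, some (c, PopRes.popped o) => if c = φ.cur then some (PopSt.done o) else none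
  | _, _ => none

/-- Encode a pop state (setting the pending record accordingly). [folklore] -/
def encPop (φ : P.Reg) : PopSt Bool → P.Reg
  | PopSt.seek => { φ with mo := Micro.idle, last := some (φ.cur, PopRes.notpop) }
  | PopSt.took a => { φ with mo := Micro.poTook a, last := some (φ.cur, PopRes.notpop) }
  | PopSt.done o => { φ with mo := Micro.idle, last := some (φ.cur, PopRes.popped o) }

/-- Decoding an encoded pop state. [folklore] -/
theorem decPop_encPop (φ : P.Reg) (s : PopSt Bool) : P.decPop (P.encPop φ s) = some s := by
  rcases s with _ | a | o <;> simp [decPop, encPop]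

/-- The state of the history mechanism: push flag, current instruction, pending record (all
rewritten by the history push and its commit). [folklore] -/
abbrev HSt : Type := Bool × P.PC × Option P.Rec

/-- Decode the history state (always defined). [folklore] -/
def decH (φ : P.Reg) : Option P.HSt := some (φ.mh, φ.cur, φ.last)

/-- Encode the history state. [folklore] -/
def encH (φ : P.Reg) (s : P.HSt) : P.Reg := { φ with mh := s.1, cur := s.2.1, last := s.2.2 }

/-- Lift laws: push on a stack track. [folklore] -/
theorem liftLaws_push_R (k : Fin P.K) : LiftLaws P.decPush P.encPush (P.getR k) (P.setR k) where
  dec_enc φ s _ _ := P.decPush_encPush φ s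
  enc_dec φ s h := by
    obtain ⟨a, b, c, d, mo, f⟩ := φ
    rcases mo with _ | _ | _ | _ | _ <;> rcases s with _ | _ <;> simp [decPush] at h <;> rfl
  enc_inj φ φ' s s' _ _ _ _ h := by
    obtain ⟨a, b, c, d, e, f⟩ := φ; obtain ⟨a', b', c', d', e', f'⟩ := φ'
    have hs : s = s' := by
      have hm := congrArg Reg.mo h
      rcases s with _ | _ <;> rcases s' with _ | _ <;> first | rfl | (simp [encPush] at hm)
    subst hs
    rcases s with _ | _ <;> simp only [encPush, Reg.mk.injEq] at h <;> obtain ⟨h1, h2, h3, h4, -, h6⟩ := h <;>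
      exact ⟨rfl, fun t => by cases t <;> simp [encPush, h1, h2, h3, h4, h6]⟩
  get_set := P.getR_setR k
  set_get := P.setR_getR k
  set_inj := P.setR_inj k

/-- Lift laws: push on the qubit track. [folklore] -/
theorem liftLaws_push_Q : LiftLaws P.decPush P.encPush P.getQ P.setQ where
  dec_enc φ s _ _ := P.decPush_encPush φ s
  enc_dec φ s h := by
    obtain ⟨a, b, c, d, mo, f⟩ := φ
    rcases mo with _ | _ | _ | _ | _ <;> rcases s with _ | _ <;> simp [decPush] at h <;> rfl
  enc_inj φ φ' s s' _ _ _ _ h := by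
    obtain ⟨a, b, c, d, e, f⟩ := φ; obtain ⟨a', b', c', d', e', f'⟩ := φ'
    have hs : s = s' := by
      have hm := congrArg Reg.mo h
      rcases s with _ | _ <;> rcases s' with _ | _ <;> first | rfl | (simp [encPush] at hm)
    subst hs
    rcases s with _ | _ <;> simp only [encPush, Reg.mk.injEq] at h <;> obtain ⟨h1, h2, h3, h4, -, h6⟩ := h <;>
      exact ⟨rfl, fun t => by cases t <;> simp [encPush, h1, h2, h3, h4, h6]⟩
  get_set := P.getQ_setQ
  set_get := P.setQ_getQ
  set_inj := P.setQ_inj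

/-- Lift laws: rotation. [folklore] -/
theorem liftLaws_rot : LiftLaws P.decRot P.encRot P.getQ P.setQ where
  dec_enc φ s _ _ := P.decRot_encRot φ s
  enc_dec φ s h := by
    obtain ⟨a, b, c, d, mo, f⟩ := φ
    rcases mo with _ | _ | x | x | x <;> rcases s with _ | y | y <;>
      simp [decRot] at h <;> first | rfl | (subst h; rfl)
  enc_inj φ φ' s s' _ _ _ _ h := by
    obtain ⟨a, b, c, d, e, f⟩ := φ; obtain ⟨a', b', c', d', e', f'⟩ := φ'
    have hs : s = s' := by
      have hm := congrArg Reg.mo h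
      rcases s with _ | x | x <;> rcases s' with _ | y | y <;>
        simp only [encRot, reduceCtorEq, Micro.roCarry.injEq, Micro.roPend.injEq] at hm <;>
        first | rfl | (subst hm; rfl)
    subst hs
    rcases s with _ | x | x <;> simp only [encRot, Reg.mk.injEq] at h <;> obtain ⟨h1, h2, h3, h4, -, h6⟩ := h <;>
      exact ⟨rfl, fun t => by cases t <;> simp [encRot, h1, h2, h3, h4, h6]⟩
  get_set := P.getQ_setQ
  set_get := P.setQ_getQ
  set_inj := P.setQ_inj

/-- Lift laws: the parked qubits on the qubit track. [folklore] -/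
theorem liftLaws_park : LiftLaws P.decPark P.encPark P.getQ P.setQ where
  dec_enc φ s s₀ h := by
    unfold decPark at h ⊢
    by_cases hm : φ.mo = Micro.idle
    · simp [encPark, hm]
    · simp [hm] at h
  enc_dec φ s h := by
    unfold decPark at h
    by_cases hm : φ.mo = Micro.idle
    · simp [hm] at h; subst h; rfl
    · simp [hm] at h
  enc_inj φ φ' s s' _ _ _ _ h := by
    obtain ⟨a, b, c, d, e, f⟩ := φ; obtain ⟨a', b', c', d', e', f'⟩ := φ'
    simp only [encPark, Reg.mk.injEq] at h
    obtain ⟨h1, h2, h3, h4, h5, h6⟩ := h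
    exact ⟨h6, fun t => by simp [encPark, h1, h2, h3, h4, h5]⟩
  get_set := P.getQ_setQ
  set_get := P.setQ_getQ
  set_inj := P.setQ_inj

/-- Lift laws: pop on a stack track. [folklore] -/
theorem liftLaws_pop (k : Fin P.K) : LiftLaws P.decPop P.encPop (P.getR k) (P.setR k) where
  dec_enc φ s _ _ := P.decPop_encPop φ s
  enc_dec φ s h := by
    obtain ⟨a, cur, last, d, mo, f⟩ := φ
    rcases mo with _ | _ | x | x | x <;> rcases last with _ | ⟨c, _ | o'⟩ <;>
      simp [decPop] at h <;> (obtain ⟨rfl, rfl⟩ := h; rfl)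
  enc_inj φ φ' s s' _ _ _ _ h := by
    obtain ⟨a, b, c, d, e, f⟩ := φ; obtain ⟨a', b', c', d', e', f'⟩ := φ'
    have h' : ∀ u : PopSt Bool,
        (⟨a, b, c, d, e, f⟩ : P.Reg).ini = a' ∧ b = b' ∧ d = d' ∧ f = f' →
        ∀ t, P.encPop ⟨a, b, c, d, e, f⟩ t = P.encPop ⟨a', b', c', d', e', f'⟩ t := by
      rintro u ⟨rfl, rfl, rfl, rfl⟩ t
      cases t <;> rfl
    have hs : s = s' := by
      have hm := congrArg Reg.mo h
      have hl := congrArg Reg.last h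
      rcases s with _ | x | x <;> rcases s' with _ | y | y <;>
        simp only [encPop, reduceCtorEq, Micro.poTook.injEq, Option.some.injEq, Prod.mk.injEq,
          PopRes.popped.injEq] at hm hl <;>
        first | rfl | (subst hm; rfl) | (obtain ⟨-, h2⟩ := hl; subst h2; rfl) | exact absurd hl.2 (by simp)
    subst hs
    refine ⟨rfl, h' s ?_⟩
    rcases s with _ | x | x <;> simp only [encPop, Reg.mk.injEq] at h <;>
      exact ⟨h.1, h.2.1, h.2.2.2.1, h.2.2.2.2.2⟩
  get_set := P.getR_setR k
  set_get := P.setR_getR k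
  set_inj := P.setR_inj k

/-- Lift laws: the history mechanism. [folklore] -/
theorem liftLaws_H : LiftLaws P.decH P.encH P.getH P.setH where
  dec_enc _ _ _ _ := rfl
  enc_dec φ s h := by cases h; rfl
  enc_inj φ φ' s s' _ _ _ _ h := by
    obtain ⟨a, b, c, d, e, f⟩ := φ; obtain ⟨a', b', c', d', e', f'⟩ := φ'
    obtain ⟨s1, s2, s3⟩ := s; obtain ⟨t1, t2, t3⟩ := s'
    simp only [encH, Reg.mk.injEq] at h
    obtain ⟨h1, h2, h3, h4, h5, h6⟩ := h
    subst h1 h2 h3 h4 h5 h6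
    exact ⟨rfl, fun t => rfl⟩
  get_set := P.getH_setH
  set_get := P.setH_getH
  set_inj := P.setH_inj

end Codes

/-! ### The remaining track rules: bounded parked lists, read, history push, init -/

section Specs

/-- Wrapping a rule on (parked list, symbol) to bounded lists (outputs beyond the bound are
dropped; they do not occur). [folklore] -/
def wrapB (spec : List Bool × TSym Bool → Option (List Bool × TSym Bool)) (x : BList P.amax × TSym Bool) :
    Option (BList P.amax × TSym Bool) :=
  match spec (x.1.1, x.2) with
  | none => none
  | some y => if h : y.1.length ≤ P.amax then some (⟨y.1, h⟩, y.2) else none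

/-- Wrapping preserves injectivity. [folklore] -/
theorem wrapB_injective {spec : List Bool × TSym Bool → Option (List Bool × TSym Bool)}
    (hspec : PartialInjective spec) : PartialInjective (P.wrapB spec) := by
  rintro ⟨l, t⟩ ⟨l', t'⟩ y h h'
  unfold wrapB at h h'
  cases hx : spec (l.1, t) with
  | none => rw [hx] at h; simp at h
  | some z =>
    cases hx' : spec (l'.1, t') with
    | none => rw [hx'] at h'; simp at h'
    | some z' =>
      rw [hx] at h; rw [hx'] at h'
      simp only at h h'
      split_ifs at h h' with h1 h2
      cases h
      simp only [Option.some.injEq, Prod.mk.injEq, Subtype.mk.injEq] at h'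
      have hz : z = z' := Prod.ext h'.1.symm h'.2.symm
      subst hz
      have := hspec hx hx'
      simp only [Prod.mk.injEq] at this
      exact Prod.ext (Subtype.ext this.1) this.2

/-- If `spec x = some y` with a short output, the wrapped rule agrees. [folklore] -/
theorem wrapB_eq_some {spec : List Bool × TSym Bool → Option (List Bool × TSym Bool)}
    (l : BList P.amax) (t : TSym Bool) (l' : List Bool) (t' : TSym Bool) (h : spec (l.1, t) = some (l', t'))
    (hl' : l'.length ≤ P.amax) : P.wrapB spec (l, t) = some (⟨l', hl'⟩, t') := by
  unfold wrapB; rw [h]; simp [hl']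

/-- **The read rule** (partial; state = parked list): take the front qubit of the queue into the
(empty) register, leaving a dead cell; pass everything else. [cite: NishimuraOzawa2002, Lemma 5.1] -/
def readSpec : List Bool × TSym Bool → Option (List Bool × TSym Bool)
  | ([], TSym.free) => some ([], TSym.free)
  | ([], TSym.cell Base.anc h) => some ([], TSym.cell Base.anc h)
  | ([], TSym.cell Base.dead false) => some ([], TSym.cell Base.dead false)
  | ([], TSym.cell (Base.sym a) h) => some ([a], TSym.cell Base.dead h)
  | ([a], TSym.cell (Base.sym x) h) => some ([a], TSym.cell (Base.sym x) h)
  | ([a], TSym.free) => some ([a], TSym.free)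
  | _ => none

/-- A partial left inverse of the read rule. [folklore] -/
def unread : List Bool × TSym Bool → Option (List Bool × TSym Bool)
  | ([], TSym.free) => some ([], TSym.free)
  | ([], TSym.cell Base.anc h) => some ([], TSym.cell Base.anc h)
  | ([], TSym.cell Base.dead false) => some ([], TSym.cell Base.dead false)
  | ([a], TSym.cell Base.dead h) => some ([], TSym.cell (Base.sym a) h)
  | ([a], TSym.cell (Base.sym x) h) => some ([a], TSym.cell (Base.sym x) h)
  | ([a], TSym.free) => some ([a], TSym.free)
  | _ => none

/-- `unread` inverts `readSpec` on its domain. [folklore] -/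
theorem unread_of_readSpec {x y : List Bool × TSym Bool} (h : readSpec x = some y) : unread y = some x := by
  obtain ⟨l, t⟩ := x
  rcases l with _ | ⟨a, _ | ⟨b, l⟩⟩ <;> rcases t with _ | ⟨_ | _ | _ | c, _ | _⟩ <;>
    simp only [readSpec, reduceCtorEq, Option.some.injEq] at h <;> subst h <;> rfl

/-- The read rule is one-to-one. [cite: BernsteinVaziraniSICOMP1997, App. B (Def. B.1)] -/
theorem readSpec_injective : PartialInjective readSpec := fun _ _ _ hx hy =>
  Option.some.inj ((unread_of_readSpec hx).symm.trans (unread_of_readSpec hy))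

/-- **The history rule** (partial) on (history state, history symbol), rightward pass: pass
free and unhatted cells; at the hatted top of the history stack drop the hat (write pending);
on the next (free) cell write the pending record hatted and COMMIT — the next instruction becomes
current, the pending record is cleared (Bernstein–Vazirani 1997, §4: the history of a reversible
simulation). The pending record must be that of the current instruction. [cite: BernsteinVaziraniSICOMP1997, §4] -/
def hSpec (next : P.Rec → P.PC) : P.HSt × TSym P.HSym → Option (P.HSt × TSym P.HSym)
  | ((false, c, last), TSym.free) => some ((false, c, last), TSym.free)
  | ((false, c, last), TSym.cell x false) => some ((false, c, last), TSym.cell x false)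
  | ((false, c, last), TSym.cell x true) => some ((true, c, last), TSym.cell x false)
  | ((true, c, some r), TSym.free) =>
      if r.1 = c then some ((false, next r, none), TSym.cell (Base.sym r) true) else none
  | _ => none

/-- A partial left inverse of the history rule. [folklore] -/
def unh : P.HSt × TSym P.HSym → Option (P.HSt × TSym P.HSym)
  | ((false, c, last), TSym.free) => some ((false, c, last), TSym.free)
  | ((false, c, last), TSym.cell x false) => some ((false, c, last), TSym.cell x false)
  | ((true, c, last), TSym.cell x false) => some ((false, c, last), TSym.cell x true)
  | ((false, _, none), TSym.cell (Base.sym r) true) => some ((true, r.1, some r), TSym.free)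
  | _ => none

/-- `unh` inverts `hSpec` on its domain. [folklore] -/
theorem unh_of_hSpec (next : P.Rec → P.PC) {x y : P.HSt × TSym P.HSym} (h : P.hSpec next x = some y) :
    P.unh y = some x := by
  obtain ⟨⟨mh, c, last⟩, t⟩ := x
  rcases mh with _ | _ <;> rcases last with _ | r <;> rcases t with _ | ⟨_ | _ | _ | z, _ | _⟩ <;>
    simp only [hSpec, reduceCtorEq, Option.some.injEq] at h <;>
    first
    | (subst h; rfl)
    | (split_ifs at h with hr
       cases h
       simp [unh, ← hr])

/-- The history rule is one-to-one. [cite: BernsteinVaziraniSICOMP1997, App. B (Def. B.1)] -/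
theorem hSpec_injective (next : P.Rec → P.PC) : PartialInjective (P.hSpec next) := fun _ _ _ hx hy =>
  Option.some.inj ((P.unh_of_hSpec next hx).symm.trans (P.unh_of_hSpec next hy))

/-- On its domain the history rule preserves the *effective* instruction
`last.elim cur next`. [folklore] -/
theorem hSpec_ecur (next : P.Rec → P.PC) {x y : P.HSt × TSym P.HSym} (h : P.hSpec next x = some y) :
    (match y.1.2.2 with | some r => next r | none => y.1.2.1) =
      (match x.1.2.2 with | some r => next r | none => x.1.2.1) := by
  obtain ⟨⟨mh, c, last⟩, t⟩ := x
  rcases mh with _ | _ <;> rcases last with _ | r <;> rcases t with _ | ⟨_ | _ | _ | z, _ | _⟩ <;>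
    simp only [hSpec, reduceCtorEq, Option.some.injEq] at h <;>
    first
    | (subst h; rfl)
    | (split_ifs at h with hr
       cases h
       rfl)

/-- **The two-phase push rule** (partial): pass free and unhatted cells; at the hatted cell drop the
hat (write pending); write the new hatted symbol on the next (free) cell and rest. [cite: BernsteinVaziraniSICOMP1997, §4] -/
def pushSpec₂ (a : Bool) : Push2 × TSym Bool → Option (Push2 × TSym Bool)
  | (Push2.seek, TSym.free) => some (Push2.seek, TSym.free)
  | (Push2.seek, TSym.cell b false) => some (Push2.seek, TSym.cell b false)
  | (Push2.seek, TSym.cell b true) => some (Push2.pend, TSym.cell b false)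
  | (Push2.pend, TSym.free) => some (Push2.seek, TSym.cell (Base.sym a) true)
  | _ => none

/-- A partial left inverse of the two-phase push rule. [folklore] -/
def unpush₂ : Push2 × TSym Bool → Option (Push2 × TSym Bool)
  | (Push2.seek, TSym.free) => some (Push2.seek, TSym.free)
  | (Push2.seek, TSym.cell b false) => some (Push2.seek, TSym.cell b false)
  | (Push2.pend, TSym.cell b false) => some (Push2.seek, TSym.cell b true)
  | (Push2.seek, TSym.cell _ true) => some (Push2.pend, TSym.free)
  | _ => none

/-- `unpush₂` inverts `pushSpec₂` on its domain (up to the written symbol). [folklore] -/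
theorem unpush₂_of_pushSpec₂ (a : Bool) {x y : Push2 × TSym Bool} (h : pushSpec₂ a x = some y) :
    unpush₂ y = some x := by
  obtain ⟨s, t⟩ := x
  rcases s with _ | _ <;> rcases t with _ | ⟨b, _ | _⟩ <;>
    simp only [pushSpec₂, reduceCtorEq, Option.some.injEq] at h <;> subst h <;> rfl

/-- The two-phase push rule is one-to-one. [cite: BernsteinVaziraniSICOMP1997, App. B (Def. B.1)] -/
theorem pushSpec₂_injective (a : Bool) : PartialInjective (pushSpec₂ a) := fun _ _ _ hx hy =>
  Option.some.inj ((unpush₂_of_pushSpec₂ a hx).symm.trans (unpush₂_of_pushSpec₂ a hy))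

/-- **The resting rotation rule** (partial): as `Track.rotSpec`, but the machine rests (returns to
`seek`) once the front qubit has been written at the back. [cite: BernsteinVaziraniSICOMP1997, §4] -/
def rotSpec₃ : Rot3 × TSym Bool → Option (Rot3 × TSym Bool)
  | (Rot3.seek, TSym.free) => some (Rot3.seek, TSym.free)
  | (Rot3.seek, TSym.cell Base.anc false) => some (Rot3.seek, TSym.cell Base.anc false)
  | (Rot3.seek, TSym.cell Base.dead false) => some (Rot3.seek, TSym.cell Base.dead false)
  | (Rot3.seek, TSym.cell (Base.sym a) false) => some (Rot3.carry a, TSym.cell Base.dead false)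
  | (Rot3.seek, TSym.cell (Base.sym a) true) => some (Rot3.pend a, TSym.cell Base.dead false)
  | (Rot3.carry a, TSym.cell (Base.sym x) false) => some (Rot3.carry a, TSym.cell (Base.sym x) false)
  | (Rot3.carry a, TSym.cell (Base.sym x) true) => some (Rot3.pend a, TSym.cell (Base.sym x) false)
  | (Rot3.pend a, TSym.free) => some (Rot3.seek, TSym.cell (Base.sym a) true)
  | _ => none

/-- A partial left inverse of the resting rotation rule. [folklore] -/
def unrot₃ : Rot3 × TSym Bool → Option (Rot3 × TSym Bool)
  | (Rot3.seek, TSym.free) => some (Rot3.seek, TSym.free)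
  | (Rot3.seek, TSym.cell Base.anc false) => some (Rot3.seek, TSym.cell Base.anc false)
  | (Rot3.seek, TSym.cell Base.dead false) => some (Rot3.seek, TSym.cell Base.dead false)
  | (Rot3.carry a, TSym.cell Base.dead false) => some (Rot3.seek, TSym.cell (Base.sym a) false)
  | (Rot3.pend a, TSym.cell Base.dead false) => some (Rot3.seek, TSym.cell (Base.sym a) true)
  | (Rot3.carry a, TSym.cell (Base.sym x) false) => some (Rot3.carry a, TSym.cell (Base.sym x) false)
  | (Rot3.pend a, TSym.cell (Base.sym x) false) => some (Rot3.carry a, TSym.cell (Base.sym x) true)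
  | (Rot3.seek, TSym.cell (Base.sym a) true) => some (Rot3.pend a, TSym.free)
  | _ => none

/-- `unrot₃` inverts `rotSpec₃` on its domain. [folklore] -/
theorem unrot₃_of_rotSpec₃ {x y : Rot3 × TSym Bool} (h : rotSpec₃ x = some y) : unrot₃ y = some x := by
  obtain ⟨s, t⟩ := x
  rcases s with _ | a | a <;> rcases t with _ | ⟨_ | _ | _ | a', _ | _⟩ <;>
    simp only [rotSpec₃, reduceCtorEq, Option.some.injEq] at h <;> subst h <;> rfl

/-- The resting rotation rule is one-to-one. [cite: BernsteinVaziraniSICOMP1997, App. B (Def. B.1)] -/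
theorem rotSpec₃_injective : PartialInjective rotSpec₃ := fun _ _ _ hx hy =>
  Option.some.inj ((unrot₃_of_rotSpec₃ hx).symm.trans (unrot₃_of_rotSpec₃ hy))

end Specs

/-! ### The next instruction -/

/-- **The next instruction** after the record `(pc, res)` (jumps beyond the end halt; at the
halting address nothing happens). [cite: NishimuraOzawa2002, Lemma 5.1] -/
def next (r : P.Rec) : P.PC :=
  match P.instr r.1 with
  | none => r.1
  | some (QInstr.push _ _) => P.clamp (r.1.1 + 1)
  | some (QInstr.pop _ j) =>
      match r.2 with
      | PopRes.popped o => P.clamp (j o)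
      | PopRes.notpop => P.clamp (j none)
  | some (QInstr.goto j) => P.clamp j
  | some (QInstr.qpush _ j) => P.clamp j
  | some (QInstr.qrot j) => P.clamp j
  | some (QInstr.qgate _ j) => P.clamp j
  | some (QInstr.qread j) => P.clamp j

/-! ### Finiteness of the micro-state types over `Bool` -/

/-- Pop micro-states over a finite alphabet are finite. [folklore] -/
instance instFintypePopSt : Fintype (PopSt Bool) :=
  Fintype.ofEquiv (Option (Bool ⊕ Option Bool))
    { toFun := fun x => match x with
        | none => PopSt.seek
        | some (Sum.inl a) => PopSt.took a
        | some (Sum.inr o) => PopSt.done o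
      invFun := fun s => match s with
        | PopSt.seek => none
        | PopSt.took a => some (Sum.inl a)
        | PopSt.done o => some (Sum.inr o)
      left_inv := fun x => by rcases x with _ | (a | o) <;> rfl
      right_inv := fun s => by rcases s with _ | a | o <;> rfl }

/-- Decidable equality of history states. [folklore] -/
instance instDecEqHSt : DecidableEq P.HSt := inferInstance
/-- Decidable equality of history symbols. [folklore] -/
instance instDecEqHSym : DecidableEq P.HSym := inferInstance
/-- Decidable equality of history track symbols. [folklore] -/
instance instDecEqTSymHSym : DecidableEq (TSym P.HSym) := inferInstance
/-- Finiteness of history track symbols. [folklore] -/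
instance instFintypeTSymHSym : Fintype (TSym P.HSym) := inferInstance

/-! ### The track bijections -/

/-- Push (two-phase). [cite: BernsteinVaziraniSICOMP1997, App. B (Cor. B.2)] -/
def pushPerm (b : Bool) : Push2 × TSym Bool ≃ Push2 × TSym Bool := completeRule (pushSpec₂ b) (pushSpec₂_injective b)
/-- Rotate (resting). [cite: BernsteinVaziraniSICOMP1997, App. B (Cor. B.2)] -/
def rotPerm : Rot3 × TSym Bool ≃ Rot3 × TSym Bool := completeRule rotSpec₃ rotSpec₃_injective
/-- Pop. [cite: BernsteinVaziraniSICOMP1997, App. B (Cor. B.2)] -/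
def popPerm : PopSt Bool × TSym Bool ≃ PopSt Bool × TSym Bool := completeRule popSpec popSpec_injective
/-- Gather `k`. [cite: BernsteinVaziraniSICOMP1997, App. B (Cor. B.2)] -/
def gathPerm (k : ℕ) : BList P.amax × TSym Bool ≃ BList P.amax × TSym Bool :=
  completeRule (P.wrapB (gathSpec k)) (P.wrapB_injective (gathSpec_injective k))
/-- Return `k`. [cite: BernsteinVaziraniSICOMP1997, App. B (Cor. B.2)] -/
def retPerm (k : ℕ) : BList P.amax × TSym Bool ≃ BList P.amax × TSym Bool :=
  completeRule (P.wrapB (retSpec k)) (P.wrapB_injective (retSpec_injective k))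
/-- Read. [cite: BernsteinVaziraniSICOMP1997, App. B (Cor. B.2)] -/
def readPerm : BList P.amax × TSym Bool ≃ BList P.amax × TSym Bool :=
  completeRule (P.wrapB readSpec) (P.wrapB_injective readSpec_injective)
/-- History push. [cite: BernsteinVaziraniSICOMP1997, App. B (Cor. B.2)] -/
def hPerm : P.HSt × TSym P.HSym ≃ P.HSt × TSym P.HSym := completeRule (P.hSpec P.next) (P.hSpec_injective P.next)

/-! ### The cell rules -/

/-- **The init rule** (first sweep, rightward over the input cells): on a cell holding an
unhatted qubit, toggle the input-register track between free and an unhatted `1` (only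
free ↦ `1` occurs: the input register receives `1ⁿ`). An involution. [cite: BernsteinVaziraniSICOMP1997, §4] -/
def iniRule (x : P.Reg × P.Cell) : P.Reg × P.Cell :=
  match x.2.q, x.2.regs P.U with
  | TSym.cell (Base.sym _) false, TSym.free => (x.1, P.setR P.U x.2 (TSym.cell (Base.sym true) false))
  | TSym.cell (Base.sym _) false, TSym.cell (Base.sym true) false => (x.1, P.setR P.U x.2 TSym.free)
  | _, _ => x

/-- The init rule on a cell. [folklore] -/
theorem iniRule_apply (φ : P.Reg) (c : P.Cell) :
    P.iniRule (φ, c) =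
      match c.q, c.regs P.U with
      | TSym.cell (Base.sym _) false, TSym.free => (φ, P.setR P.U c (TSym.cell (Base.sym true) false))
      | TSym.cell (Base.sym _) false, TSym.cell (Base.sym true) false => (φ, P.setR P.U c TSym.free)
      | _, _ => (φ, c) := rfl

/-- The init rule is an involution. [folklore] -/
theorem iniRule_involutive : Function.Involutive P.iniRule := by
  rintro ⟨φ, c⟩
  obtain ⟨tag, q, h, regs⟩ := c
  by_cases hq : ∃ b, q = TSym.cell (Base.sym b) false
  · obtain ⟨b, rfl⟩ := hq
    by_cases hu : regs P.U = TSym.free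
    · have h1 : P.iniRule (φ, ⟨tag, TSym.cell (Base.sym b) false, h, regs⟩) =
          (φ, ⟨tag, TSym.cell (Base.sym b) false, h, Function.update regs P.U (TSym.cell (Base.sym true) false)⟩) := by
        simp [iniRule_apply, hu, setR]
      rw [h1]
      simp [iniRule_apply, setR, ← hu]
    · by_cases hu' : regs P.U = TSym.cell (Base.sym true) false
      · have h1 : P.iniRule (φ, ⟨tag, TSym.cell (Base.sym b) false, h, regs⟩) =
            (φ, ⟨tag, TSym.cell (Base.sym b) false, h, Function.update regs P.U TSym.free⟩) := by
          simp [iniRule_apply, hu', setR]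
        rw [h1]
        simp [iniRule_apply, setR, ← hu']
      · have h1 : P.iniRule (φ, ⟨tag, TSym.cell (Base.sym b) false, h, regs⟩) =
            (φ, ⟨tag, TSym.cell (Base.sym b) false, h, regs⟩) := by
          rw [iniRule_apply]
          rcases hr : regs P.U with _ | ⟨_ | _ | _ | (_ | _), _ | _⟩ <;> simp_all
        rw [h1, h1]
  · have h1 : P.iniRule (φ, ⟨tag, q, h, regs⟩) = (φ, ⟨tag, q, h, regs⟩) := by
      rw [iniRule_apply]
      rcases q with _ | ⟨_ | _ | _ | b, _ | _⟩ <;> simp_all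
    rw [h1, h1]

/-- **The effective instruction** of a control state: the next instruction of the pending record
if there is one (the record is not yet committed), the current instruction otherwise. It is the
instruction whose rightward operation is being carried out. [cite: BernsteinVaziraniSICOMP1997, §4] -/
def ecur (φ : P.Reg) : P.PC :=
  match φ.last with
  | some r => P.next r
  | none => φ.cur

/-- **The history part of the rightward rule**: the history push with commit, on the history track
and the components (push flag, current instruction, pending record). [cite: BernsteinVaziraniSICOMP1997, §4] -/
def hR (x : P.Reg × P.Cell) : P.Reg × P.Cell := liftRule P.hPerm P.decH P.encH P.getH P.setH x

/-- **The rightward operation of instruction `e`** on its track (push on a stack track; qpush,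
rotate, gather, read on the qubit track), the identity for the other instructions. [cite: NishimuraOzawa2002, Lemma 5.1] -/
def opRAt (e : P.PC) (x : P.Reg × P.Cell) : P.Reg × P.Cell :=
  match P.instr e with
  | some (QInstr.push k b) => liftRule (pushPerm b) P.decPush P.encPush (P.getR k) (P.setR k) x
  | some (QInstr.qpush b _) => liftRule (pushPerm b) P.decPush P.encPush P.getQ P.setQ x
  | some (QInstr.qrot _) => liftRule rotPerm P.decRot P.encRot P.getQ P.setQ x
  | some (QInstr.qgate g _) => liftRule (P.gathPerm (P.G.arity g)) P.decPark P.encPark P.getQ P.setQ x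
  | some (QInstr.qread _) => liftRule P.readPerm P.decPark P.encPark P.getQ P.setQ x
  | _ => x

/-- **The operating part of the rightward rule**: the rightward operation of the EFFECTIVE
instruction. [cite: NishimuraOzawa2002, Lemma 5.1] -/
def opRFun (x : P.Reg × P.Cell) : P.Reg × P.Cell := P.opRAt (P.ecur x.1) x

/-- **The rightward rule**: the init rule on the first sweep; otherwise the history part followed
by the operating part. [cite: NishimuraOzawa2002, Lemma 5.1] -/
def ruleRFun (x : P.Reg × P.Cell) : P.Reg × P.Cell :=
  if x.1.ini then P.iniRule x else P.opRFun (P.hR x)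

/-- **The leftward rule**: pop on a stack track, return on the qubit track (by the current
instruction), the identity otherwise. [cite: NishimuraOzawa2002, Lemma 5.1] -/
def ruleLFun (x : P.Reg × P.Cell) : P.Reg × P.Cell :=
  if x.1.ini then x
  else match P.instr x.1.cur with
    | some (QInstr.pop k _) => liftRule popPerm P.decPop P.encPop (P.getR k) (P.setR k) x
    | some (QInstr.qgate g _) => liftRule (P.retPerm (P.G.arity g)) P.decPark P.encPark P.getQ P.setQ x
    | _ => x

/-! ### The cell rules are bijections -/

section Bijective

variable {P}

/-- A lift preserves whatever its encoder preserves. [folklore] -/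
theorem liftRule_fst_eq {S α : Type} (perm : S × TSym α → S × TSym α) (dec : P.Reg → Option S)
    (enc : P.Reg → S → P.Reg) (get : P.Cell → TSym α) (set : P.Cell → TSym α → P.Cell) {β : Type} (f : P.Reg → β)
    (hf : ∀ φ s, f (enc φ s) = f φ) (x : P.Reg × P.Cell) : f (liftRule perm dec enc get set x).1 = f x.1 := by
  unfold liftRule
  cases dec x.1 <;> simp [hf]

variable (P)

/-- The operation of an instruction preserves the effective instruction. [folklore] -/
theorem opRAt_ecur (e : P.PC) (x : P.Reg × P.Cell) : P.ecur (P.opRAt e x).1 = P.ecur x.1 := by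
  unfold opRAt
  split <;> first | rfl | (apply liftRule_fst_eq; intro _ s; cases s <;> rfl)

/-- The operation of an instruction preserves the init flag. [folklore] -/
theorem opRAt_ini (e : P.PC) (x : P.Reg × P.Cell) : (P.opRAt e x).1.ini = x.1.ini := by
  unfold opRAt
  split <;> first | rfl | (apply liftRule_fst_eq; intro _ s; cases s <;> rfl)

/-- The operating part preserves the effective instruction. [folklore] -/
theorem opRFun_ecur (x : P.Reg × P.Cell) : P.ecur (P.opRFun x).1 = P.ecur x.1 := P.opRAt_ecur _ x

/-- The operating part preserves the init flag. [folklore] -/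
theorem opRFun_ini (x : P.Reg × P.Cell) : (P.opRFun x).1.ini = x.1.ini := P.opRAt_ini _ x

/-- The history part preserves the init flag. [folklore] -/
theorem hR_ini (x : P.Reg × P.Cell) : (P.hR x).1.ini = x.1.ini := by
  unfold hR
  exact liftRule_fst_eq P.hPerm P.decH P.encH P.getH P.setH Reg.ini (fun _ _ => rfl) x

/-- The rightward rule preserves the init flag. [folklore] -/
theorem ruleRFun_ini (x : P.Reg × P.Cell) : (P.ruleRFun x).1.ini = x.1.ini := by
  unfold ruleRFun
  split_ifs with h
  · rw [iniRule_apply]; split <;> rfl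
  · rw [opRFun_ini, hR_ini]

/-- The leftward rule preserves the init flag. [folklore] -/
theorem ruleLFun_ini (x : P.Reg × P.Cell) : (P.ruleLFun x).1.ini = x.1.ini := by
  unfold ruleLFun
  split_ifs with h
  · rfl
  · split <;> first | rfl | (apply liftRule_fst_eq; intro _ s; cases s <;> rfl)

/-- The leftward rule preserves the current instruction (run mode). [folklore] -/
theorem ruleLFun_cur (x : P.Reg × P.Cell) (h : x.1.ini = false) : (P.ruleLFun x).1.cur = x.1.cur := by
  unfold ruleLFun
  rw [if_neg (by simp [h])]
  split <;> first | rfl | (apply liftRule_fst_eq; intro _ s; cases s <;> rfl)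

/-- **The operating part of the rightward rule is one-to-one.** [cite: BernsteinVaziraniSICOMP1997, App. B (Def. B.1)] -/
theorem opRFun_injective : Function.Injective P.opRFun := by
  intro x y h
  have he : P.ecur x.1 = P.ecur y.1 := by rw [← P.opRFun_ecur x, h, P.opRFun_ecur]
  unfold opRFun opRAt at h
  rw [← he] at h
  rcases hi : P.instr (P.ecur x.1) with _ | ⟨k, b⟩ | ⟨k, j⟩ | j | ⟨b, j⟩ | j | ⟨g, j⟩ | j <;> rw [hi] at h <;>
    simp only at h
  · exact h
  · exact liftRule_injective (pushPerm b).injective (P.liftLaws_push_R k) h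
  · exact h
  · exact h
  · exact liftRule_injective (pushPerm b).injective P.liftLaws_push_Q h
  · exact liftRule_injective rotPerm.injective P.liftLaws_rot h
  · exact liftRule_injective (P.gathPerm _).injective P.liftLaws_park h
  · exact liftRule_injective P.readPerm.injective P.liftLaws_park h

/-- **The history part is one-to-one.** [cite: BernsteinVaziraniSICOMP1997, App. B (Def. B.1)] -/
theorem hR_injective : Function.Injective P.hR :=
  liftRule_injective P.hPerm.injective P.liftLaws_H

/-- **The rightward rule is one-to-one.** [cite: BernsteinVaziraniSICOMP1997, App. B (Def. B.1)] -/
theorem ruleRFun_injective : Function.Injective P.ruleRFun := by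
  intro x y h
  have hini : x.1.ini = y.1.ini := by rw [← P.ruleRFun_ini x, h, P.ruleRFun_ini]
  by_cases hx : x.1.ini = true
  · have hy : y.1.ini = true := hini ▸ hx
    unfold ruleRFun at h
    rw [if_pos hx, if_pos hy] at h
    exact P.iniRule_involutive.injective h
  · have hy : ¬ y.1.ini = true := by rw [← hini]; exact hx
    unfold ruleRFun at h
    rw [if_neg hx, if_neg hy] at h
    exact P.hR_injective (P.opRFun_injective h)

/-- **The leftward rule is one-to-one.** [cite: BernsteinVaziraniSICOMP1997, App. B (Def. B.1)] -/
theorem ruleLFun_injective : Function.Injective P.ruleLFun := by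
  intro x y h
  have hini : x.1.ini = y.1.ini := by rw [← P.ruleLFun_ini x, h, P.ruleLFun_ini]
  by_cases hx : x.1.ini = true
  · have hy : y.1.ini = true := hini ▸ hx
    unfold ruleLFun at h
    rw [if_pos hx, if_pos hy] at h
    exact h
  · have hx' : x.1.ini = false := by simpa using hx
    have hy' : y.1.ini = false := hini ▸ hx'
    have hcur : x.1.cur = y.1.cur := by rw [← P.ruleLFun_cur x hx', h, P.ruleLFun_cur y hy']
    unfold ruleLFun at h
    rw [if_neg hx, if_neg (by simp [hy']), ← hcur] at h
    rcases hi : P.instr x.1.cur with _ | ⟨k, b⟩ | ⟨k, j⟩ | j | ⟨b, j⟩ | j | ⟨g, j⟩ | j <;> rw [hi] at h <;>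
      simp only at h
    · exact h
    · exact h
    · exact liftRule_injective popPerm.injective (P.liftLaws_pop k) h
    · exact h
    · exact h
    · exact h
    · exact liftRule_injective (P.retPerm _).injective P.liftLaws_park h
    · exact h

/-- The rightward rule as a permutation of (register, cell) pairs (one-to-one on a finite set). [cite: BernsteinVaziraniSICOMP1997, App. B (Cor. B.2)] -/
def ruleR : P.Reg × P.Cell ≃ P.Reg × P.Cell :=
  Equiv.ofBijective P.ruleRFun (Finite.injective_iff_bijective.1 P.ruleRFun_injective)

/-- The leftward rule as a permutation. [cite: BernsteinVaziraniSICOMP1997, App. B (Cor. B.2)] -/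
def ruleL : P.Reg × P.Cell ≃ P.Reg × P.Cell :=
  Equiv.ofBijective P.ruleLFun (Finite.injective_iff_bijective.1 P.ruleLFun_injective)

/-- `ruleR` is `ruleRFun`. [folklore] -/
@[simp] theorem ruleR_apply (x : P.Reg × P.Cell) : P.ruleR x = P.ruleRFun x := rfl
/-- `ruleL` is `ruleLFun`. [folklore] -/
@[simp] theorem ruleL_apply (x : P.Reg × P.Cell) : P.ruleL x = P.ruleLFun x := rfl

end Bijective

/-! ### The sweep specification of a program -/

/-- The accepting register value at a boundary: halted (`cur = L`, its record pending), the
read-out qubit `|1⟩` parked. [cite: NishimuraOzawa2002, Lemma 5.1] -/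
def accReg : P.Reg := ⟨false, Fin.last _, some (Fin.last _, PopRes.notpop), false, Micro.idle, ⟨[true], P.amax_pos⟩⟩

/-- **The sweep specification of the program `P`.** [cite: NishimuraOzawa2002, Lemma 5.1] -/
abbrev spec : SweepSpec where
  Φ := P.Reg
  C := P.Cell
  φ₀ := P.iniReg
  φa := P.accReg
  inp := P.inp
  pad := P.pad
  anchorL := P.anchorL
  anchorR := P.anchorR
  pad_ne_anchorL := P.pad_ne_anchorL
  pad_ne_anchorR := P.pad_ne_anchorR
  ruleR := P.ruleR
  ruleL := P.ruleL
  turn := P.turn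
  turn_unitary := P.turn_unitary

/-- **The quantum Turing machine of the program `P`**: the sweep machine of its specification. [cite: NishimuraOzawa2002, Lemma 5.1] -/
abbrev machine : QTM := P.spec.machine

/-- It is Bernstein–Vazirani well formed. [cite: BernsteinVaziraniSICOMP1997, Def. 3.3 and Thm. 5.3] -/
theorem machine_pIsWellFormed : P.machine.PIsWellFormed := P.spec.machine_pIsWellFormed

/-- It is well formed in the tree's model. [cite: BernsteinVaziraniSICOMP1997, Thm. 5.3] -/
theorem machine_isWellFormed : P.machine.IsWellFormed := P.spec.machine_isWellFormed

/-- The entries of the gate matrices of `P`. [folklore] -/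
def gateEntries : Set ℂ := {z | ∃ (g : P.G.Op) (x y : QReg (P.G.arity g)), P.G.mat g x y = z}

/-- The gate amplitude takes values `0`, `1` or entries of gate matrices. [folklore] -/
theorem gateAmp_mem (φ ψ : P.Reg) : P.gateAmp φ ψ ∈ insert (0 : ℂ) (insert 1 P.gateEntries) := by
  unfold gateAmp
  split
  · split_ifs
    · exact Or.inr (Or.inr ⟨_, _, _, rfl⟩)
    · exact Or.inl rfl
    · exact Or.inr (Or.inl rfl)
    · exact Or.inl rfl
  · split_ifs
    · exact Or.inr (Or.inl rfl)
    · exact Or.inl rfl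

/-- **Amplitudes of the machine of `P`**: `0`, `1` and entries of its gate matrices (so the
machine has amplitudes in any set containing `0`, `1` and the gate entries). [cite: BernsteinVaziraniSICOMP1997, §6 (amplitude sets)] -/
theorem machine_amplitudes_subset {T : Set ℂ} (h0 : (0 : ℂ) ∈ T) (h1 : (1 : ℂ) ∈ T) (hG : P.gateEntries ⊆ T) :
    P.machine.amplitudes ⊆ T :=
  P.spec.machine_amplitudes_subset h0 h1 fun φ ψ => by
    show P.gateAmp (P.turnσ φ) ψ ∈ T
    rcases P.gateAmp_mem (P.turnσ φ) ψ with h | h | h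
    · rw [h]; exact h0
    · rw [h]; exact h1
    · exact hG h

end Prog

end QSM

end QTM

end Literature.Computability.Cryptography
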